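import Literature.Algebra.EuclideanLattices.LatticePeriodicFunctions
import Literature.Analysis.FunctionSpaces.TorusScalarFourierSeries
import Mathlib.MeasureTheory.Measure.Haar.Unique
import HarnessLib

/-!
# Fourier coefficients of lattice-periodic functions via the coordinate torus

Topic `Literature/Algebra/EuclideanLattices`, continuing `LatticePeriodicFunctions` (full lattice
`L ≤ E`, basis `rBasis L`, fundamental parallelepiped `fdom L`, characters `echar L k`, `mean L μ`,
transport `toTorus L`, `descend`). For the harmonic analysis of smooth `L`-periodic functions
(periodised weights on the unit torus of a number field: Hecke 1920 §1, Mitsui 1956 §3) we connect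
`descend` with the calculus on `UnitAddTorus` of `Literature/Analysis/FunctionSpaces/FlatTorus`:

* `toTorus_equivFunL_symm` — `toTorus L (Ψ u) = (uᵢ mod 1)ᵢ` for the coordinate isomorphism
  `Ψ = (rBasis L).equivFunL.symm`; `lift_descend` — `Torus.lift (descend g) = g ∘ Ψ ∘ ofLp`;
  `isSmooth_descend` — `descend g` is smooth for smooth periodic `g`;
* `map_equivFunL_symm_volume` — `Ψ_* vol = μ(fdom)⁻¹ • μ` (Haar uniqueness, `Ψ '' [0,1)ⁿ = fdom`);
* **`mFourierCoeff_descend`** — `𝓕(descend g)(k) = mean L μ (e_{−k} g)`: the Fourier coefficients of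
  the descended function are the lattice means against the characters.

## References

* E. Hecke, Math. Z. 6 (1920), §1; T. Mitsui, Jap. J. Math. 26 (1956), §3. [cite: HeckeMathZ1920, §1]
* L. Grafakos, *Classical Fourier Analysis* (2014), §3.1.1. [cite: Grafakos2014, §3.1.1]

## Mathlib / tree search

Tree: `LatticePeriodic.*` (LatticePeriodicFunctions), `Torus.proj_toLp`, `Torus.IsSmooth`,
`Torus.lift_apply`. Mathlib: `UnitAddTorus.mFourierCoeff_eq_integral`,
`Measure.isAddLeftInvariant_eq_smul`, `ContinuousLinearEquiv.isAddHaarMeasure_map`,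
`Measure.univ_pi_Ioc_ae_eq_Icc`, `Measure.univ_pi_Ico_ae_eq_Icc`, `ZSpan.mem_fundamentalDomain`.
-/

noncomputable section

open MeasureTheory Module Submodule Filter Topology Complex Finset ZSpan
  Literature.Analysis.FunctionSpaces
open scoped Real

namespace Literature.Algebra.EuclideanLattices.LatticePeriodic

variable {E : Type*} [NormedAddCommGroup E] [NormedSpace ℝ E] [FiniteDimensional ℝ E]
variable (L : Submodule ℤ E) [DiscreteTopology L] [IsZLattice ℝ L]

local notation "dE" => finrank ℝ E

/-! ## The coordinate isomorphism and the torus -/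

/-- The coordinate isomorphism `Ψ : ℝⁿ ≃ E` of the basis `rBasis L`. [folklore] -/
abbrev Ψ : (Fin dE → ℝ) ≃L[ℝ] E := (rBasis L).equivFunL.symm

/-- `toTorus L (Ψ u) = (uᵢ mod 1)ᵢ`. [folklore] -/
theorem toTorus_equivFunL_symm (u : Fin dE → ℝ) : toTorus L (Ψ L u) = fun i => ((u i : ℝ) : UnitAddCircle) := by
  funext i
  simp only [toTorus]
  rw [repr_equivFunL_symm]

/-- `toTorus L (Ψ (ofLp y)) = Torus.proj y`. [folklore] -/
theorem toTorus_eq_proj (y : EuclideanSpace ℝ (Fin dE)) : toTorus L (Ψ L (WithLp.ofLp y)) = Torus.proj y := by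
  rw [toTorus_equivFunL_symm]; rfl

variable {L}

/-- `descend g (uᵢ mod 1) = g (Ψ u)` for periodic `g`. [folklore] -/
theorem descend_coe {g : E → ℂ} (hper : ∀ ℓ ∈ L, ∀ x, g (x + ℓ) = g x) (u : Fin dE → ℝ) :
    descend (L := L) g (fun i => ((u i : ℝ) : UnitAddCircle)) = g (Ψ L u) := by
  rw [← toTorus_equivFunL_symm L, descend_toTorus hper]

/-- **`Torus.lift (descend g) = g ∘ Ψ ∘ ofLp`.** [folklore] -/
theorem lift_descend {g : E → ℂ} (hper : ∀ ℓ ∈ L, ∀ x, g (x + ℓ) = g x) :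
    Torus.lift (descend (L := L) g) = fun y : EuclideanSpace ℝ (Fin dE) => g (Ψ L (WithLp.ofLp y)) := by
  funext y
  rw [Torus.lift_apply, ← toTorus_eq_proj L, descend_toTorus hper]

/-- **The descent of a smooth periodic function is smooth on the torus.** [folklore] -/
theorem isSmooth_descend {g : E → ℂ} (hg : ContDiff ℝ (⊤ : ℕ∞) g) (hper : ∀ ℓ ∈ L, ∀ x, g (x + ℓ) = g x) :
    Torus.IsSmooth (descend (L := L) g) := by
  unfold Torus.IsSmooth
  rw [lift_descend hper]
  exact hg.comp ((Ψ L).contDiff.comp (PiLp.continuousLinearEquiv 2 ℝ (fun _ : Fin dE => ℝ)).contDiff)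

/-! ## The measure transported by `Ψ` -/

variable [MeasurableSpace E] [BorelSpace E] (μ : Measure E) [μ.IsAddHaarMeasure]

variable (L) in
omit [MeasurableSpace E] [BorelSpace E] in
/-- `Ψ '' [0,1)ⁿ = fdom L`. [folklore] -/
theorem image_equivFunL_symm_cube : (Ψ L) '' {u : Fin dE → ℝ | ∀ i, u i ∈ Set.Ico (0 : ℝ) 1} = fdom L := by
  ext x
  simp only [Set.mem_image, Set.mem_setOf_eq, fdom, ZSpan.mem_fundamentalDomain]
  constructor
  · rintro ⟨u, hu, rfl⟩ i
    rw [repr_equivFunL_symm]; exact hu i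
  · intro hx
    refine ⟨fun i => (rBasis L).repr x i, hx, ?_⟩
    have : (rBasis L).equivFunL x = fun i => (rBasis L).repr x i := by
      funext i; simp [Basis.equivFunL_apply]
    rw [← this]
    exact (rBasis L).equivFunL.symm_apply_apply x

variable (L) in
/-- **`Ψ_* vol = μ(fdom)⁻¹ • μ`** (Haar uniqueness; the unit cube has volume `1` and maps onto
`fdom`). [folklore] -/
theorem map_equivFunL_symm_volume : Measure.map (Ψ L) volume = (μ (fdom L))⁻¹ • μ := by
  haveI : (Measure.map (Ψ L) volume).IsAddHaarMeasure := (Ψ L).isAddHaarMeasure_map _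
  have h := Measure.isAddLeftInvariant_eq_smul (Measure.map (Ψ L) volume) μ
  set c := Measure.addHaarScalarFactor (Measure.map (Ψ L) volume) μ with hc
  have hcube : (Measure.map (Ψ L) volume) (fdom L) = 1 := by
    rw [Measure.map_apply (Ψ L).continuous.measurable (fdom_measurableSet L), ← image_equivFunL_symm_cube L,
      (Ψ L).injective.preimage_image]
    rw [show {u : Fin dE → ℝ | ∀ i, u i ∈ Set.Ico (0 : ℝ) 1} = Set.pi Set.univ fun _ => Set.Ico (0 : ℝ) 1 by
      ext u; simp]
    rw [volume_pi_pi]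
    simp
  have hfd : μ (fdom L) ≠ 0 := measure_fdom_ne_zero L μ
  have hfd' : μ (fdom L) ≠ ⊤ := (measure_fdom_lt_top L μ).ne
  have hceq : (c : ENNReal) * μ (fdom L) = 1 := by
    have := congrArg (fun ν : Measure E => ν (fdom L)) h
    simp only [Measure.smul_apply, hcube] at this
    rw [this]; rfl
  have hcval : (c : ENNReal) = (μ (fdom L))⁻¹ := by
    rw [← mul_one (c : ENNReal), ← ENNReal.mul_inv_cancel hfd hfd', ← mul_assoc, hceq, one_mul]
  rw [h, ENNReal.smul_def, hcval]

/-! ## The Fourier coefficients of the descent are the lattice means -/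

/-- **`𝓕(descend g)(k) = mean L μ (e_{−k} · g)`** for a continuous `L`-periodic `g`.
[cite: Grafakos2014, §3.1.1] -/
theorem mFourierCoeff_descend {g : E → ℂ} (hper : ∀ ℓ ∈ L, ∀ x, g (x + ℓ) = g x) (k : Fin dE → ℤ) :
    UnitAddTorus.mFourierCoeff (descend (L := L) g) k = mean L μ (fun x => echar L (-k) x * g x) := by
  rw [UnitAddTorus.mFourierCoeff_eq_integral _ k 0]
  -- the integrand is `F ∘ Ψ`, `F = e_{-k} g`
  set F : E → ℂ := fun x => echar L (-k) x * g x with hF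
  have hint : ∀ u : Fin dE → ℝ, UnitAddTorus.mFourier (-k) (fun i => ((u i : ℝ) : UnitAddCircle)) •
      descend (L := L) g (fun i => ((u i : ℝ) : UnitAddCircle)) = F (Ψ L u) := by
    intro u
    rw [smul_eq_mul, descend_coe hper, hF]
    simp only
    rw [echar_eq_mFourier, toTorus_equivFunL_symm]
  simp_rw [Pi.zero_apply, zero_add]
  rw [setIntegral_congr_fun (by
    rw [show {x : Fin dE → ℝ | ∀ i, x i ∈ Set.Ioc (0 : ℝ) 1} = Set.pi Set.univ fun _ => Set.Ioc (0 : ℝ) 1 by ext u; simp]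
    exact MeasurableSet.univ_pi fun _ => measurableSet_Ioc) (fun u _ => hint u)]
  -- `Ioc`-cube to `Ico`-cube (null difference)
  have hae : ({x : Fin dE → ℝ | ∀ i, x i ∈ Set.Ioc (0 : ℝ) 1} : Set (Fin dE → ℝ)) =ᵐ[volume]
      ({x : Fin dE → ℝ | ∀ i, x i ∈ Set.Ico (0 : ℝ) 1} : Set (Fin dE → ℝ)) := by
    rw [show {x : Fin dE → ℝ | ∀ i, x i ∈ Set.Ioc (0 : ℝ) 1} = Set.pi Set.univ fun _ => Set.Ioc (0 : ℝ) 1 by ext u; simp,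
      show {x : Fin dE → ℝ | ∀ i, x i ∈ Set.Ico (0 : ℝ) 1} = Set.pi Set.univ fun _ => Set.Ico (0 : ℝ) 1 by ext u; simp]
    exact (Measure.univ_pi_Ioc_ae_eq_Icc (f := fun _ => (0 : ℝ)) (g := fun _ => (1 : ℝ))).trans
      (Measure.univ_pi_Ico_ae_eq_Icc (f := fun _ => (0 : ℝ)) (g := fun _ => (1 : ℝ))).symm
  rw [setIntegral_congr_set hae]
  -- change of variables along `Ψ`
  have hmp : MeasurePreserving (Ψ L) volume (Measure.map (Ψ L) volume) := ⟨(Ψ L).continuous.measurable, rfl⟩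
  have hemb : MeasurableEmbedding (Ψ L) := (Ψ L).toHomeomorph.measurableEmbedding
  rw [← hmp.setIntegral_image_emb hemb, image_equivFunL_symm_cube, map_equivFunL_symm_volume L μ, Measure.restrict_smul,
    integral_smul_measure, mean, Measure.real, ENNReal.toReal_inv]

/-! ## The Fourier expansion of a smooth periodic function -/

/-- **Absolute summability** of the lattice means `mean(e_{−k} g)` of a smooth periodic `g`. [cite: Grafakos2014, §3.3.3] -/
theorem summable_norm_mean_echar_mul {g : E → ℂ} (hg : ContDiff ℝ (⊤ : ℕ∞) g) (hper : ∀ ℓ ∈ L, ∀ x, g (x + ℓ) = g x) :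
    Summable fun k : Fin dE → ℤ => ‖mean L μ (fun x => echar L (-k) x * g x)‖ := by
  have h := Torus.summable_norm_mFourierCoeff_scalar (isSmooth_descend (L := L) hg hper)
  refine h.congr fun k => ?_
  rw [mFourierCoeff_descend μ hper]

/-- **The Fourier expansion of a smooth `L`-periodic function**:
`g(x) = ∑_k mean(e_{−k} g) e_k(x)`, absolutely convergent. [cite: Grafakos2014, §3.3.3] -/
theorem hasSum_echar {g : E → ℂ} (hg : ContDiff ℝ (⊤ : ℕ∞) g) (hper : ∀ ℓ ∈ L, ∀ x, g (x + ℓ) = g x) (x : E) :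
    HasSum (fun k : Fin dE → ℤ => mean L μ (fun y => echar L (-k) y * g y) * echar L k x) (g x) := by
  have h := Torus.hasSum_mFourier_scalar (isSmooth_descend (L := L) hg hper) (toTorus L x)
  rw [descend_toTorus hper] at h
  have heq : (fun k : Fin dE → ℤ => UnitAddTorus.mFourierCoeff (descend (L := L) g) k * UnitAddTorus.mFourier k (toTorus L x)) =
      fun k : Fin dE → ℤ => mean L μ (fun y => echar L (-k) y * g y) * echar L k x := by
    funext k
    rw [mFourierCoeff_descend μ hper, echar_eq_mFourier]
  rwa [heq] at h

/-! ## Periodizations: unfolding against a periodic factor -/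

/-- **Unfolding with a periodic factor**: `∫_{fdom} (∑_ℓ h(x+ℓ)) e(x) dx = ∫_E h e` for `h`
continuous supported in a ball and `e` continuous `L`-periodic. [folklore] -/
theorem integral_fdom_periodize_mul {h : E → ℝ} (hc : Continuous h) {R : ℝ} (hh : ∀ y, R < ‖y‖ → h y = 0)
    {e : E → ℂ} (he : Continuous e) (hpe : ∀ ℓ ∈ L, ∀ x, e (x + ℓ) = e x) :
    ∫ x in fdom L, (periodize L h x : ℂ) * e x ∂μ = ∫ x, (h x : ℂ) * e x ∂μ := by
  have : MeasurableVAdd L E := (inferInstance : MeasurableVAdd L.toAddSubgroup E)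
  have : VAddInvariantMeasure L E μ := (inferInstance : VAddInvariantMeasure L.toAddSubgroup E μ)
  obtain ⟨RD, hRD⟩ := isBounded_iff_forall_norm_le.1 (fdom_isBounded L)
  -- `h e` is integrable (continuous, compact support)
  have hsupp : HasCompactSupport (fun x => (h x : ℂ) * e x) := by
    refine HasCompactSupport.of_support_subset_isCompact (isCompact_closedBall (0 : E) R) fun y hy => ?_
    rw [Metric.mem_closedBall, dist_zero_right]
    by_contra h'
    exact hy (by simp [hh y (not_le.1 h')])
  have hint : Integrable (fun x => (h x : ℂ) * e x) μ := (by fun_prop : Continuous fun x => (h x : ℂ) * e x).integrable_of_hasCompactSupport hsupp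
  rw [(isAddFundamentalDomain L μ).integral_eq_tsum'' _ hint]
  have hvadd : ∀ (ℓ : L) (x : E), ℓ +ᵥ x = x + (ℓ : E) := fun ℓ x => by
    rw [Submodule.vadd_def, vadd_eq_add, add_comm]
  simp_rw [hvadd]
  -- periodicity of `e`
  have hpe' : ∀ (ℓ : L) (x : E), e (x + (ℓ : E)) = e x := fun ℓ x => hpe _ ℓ.2 x
  simp_rw [hpe']
  have hzero : ∀ ℓ : L, ℓ ∉ ballPts (L := L) (R + RD) → ∫ x in fdom L, (h (x + ℓ) : ℂ) * e x ∂μ = 0 := by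
    intro ℓ hℓ
    refine setIntegral_eq_zero_of_forall_eq_zero fun x hx => ?_
    rw [apply_add_eq_zero hh (hRD x hx) hℓ]; simp
  rw [tsum_eq_sum (s := ballPts (L := L) (R + RD)) (fun ℓ hℓ => hzero ℓ hℓ)]
  rw [← integral_finsetSum (ballPts (L := L) (R + RD)) (f := fun (ℓ : L) (x : E) => (h (x + (ℓ : E)) : ℂ) * e x)
    (fun ℓ _ => (integrableOn_fdom L μ (by fun_prop) : IntegrableOn (fun x : E => (h (x + (ℓ : E)) : ℂ) * e x) (fdom L) μ))]
  refine setIntegral_congr_fun (fdom_measurableSet L) fun x hx => ?_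
  rw [periodize_eq_sum hh (hRD x hx), Complex.ofReal_sum, Finset.sum_mul]

/-- **The Fourier coefficients of a periodization**: for `g = periodize L h`,
`mean(e_{−k} g) = (μ(fdom))⁻¹ ∫_E h e_{−k}`. [cite: HeckeMathZ1920, §1] -/
theorem mean_echar_mul_periodize {h : E → ℝ} (hc : Continuous h) {R : ℝ} (hh : ∀ y, R < ‖y‖ → h y = 0) (k : Fin dE → ℤ) :
    mean L μ (fun x => echar L (-k) x * (periodize L h x : ℂ)) = (μ.real (fdom L))⁻¹ * ∫ x, (h x : ℂ) * echar L (-k) x ∂μ := by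
  rw [mean, Complex.real_smul]
  congr 1
  rw [← integral_fdom_periodize_mul μ hc hh (continuous_echar L (-k)) (fun ℓ hℓ x => echar_add_of_mem L (-k) hℓ x)]
  exact setIntegral_congr_fun (fdom_measurableSet L) fun x _ => mul_comm _ _

/-! ## Iterated directional derivatives (for the derivative bounds of the descent) -/

section Derivatives

variable {V W : Type*} [NormedAddCommGroup V] [NormedSpace ℝ V] [NormedAddCommGroup W] [NormedSpace ℝ W]

/-- The iterated directional derivative `(∂_v)^m G` of `G : V → ℂ` along a fixed vector `v`. [folklore] -/
def dirIter (v : V) (m : ℕ) (G : V → ℂ) : V → ℂ := (fun H y => fderiv ℝ H y v)^[m] G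

/-- `(∂_v)^m G` is smooth with `G`. [folklore] -/
theorem contDiff_dirIter {G : V → ℂ} (hG : ContDiff ℝ (⊤ : ℕ∞) G) (v : V) (m : ℕ) : ContDiff ℝ (⊤ : ℕ∞) (dirIter v m G) := by
  induction m with
  | zero => exact hG
  | succ m ih =>
    rw [dirIter, Function.iterate_succ', Function.comp_apply, ← dirIter]
    exact (ih.fderiv_right (m := (⊤ : ℕ∞)) (by norm_cast)).clm_apply contDiff_const

/-- The recursion `(∂_v)^{m+1} G = ∂_v ((∂_v)^m G)`. [folklore] -/
theorem dirIter_succ (v : V) (m : ℕ) (G : V → ℂ) : dirIter v (m + 1) G = fun y => fderiv ℝ (dirIter v m G) y v := by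
  rw [dirIter, Function.iterate_succ']; rfl

/-- **`(∂_v)^m G (y) = D^m G(y)[v,…,v]`** for smooth `G`. [folklore] -/
theorem dirIter_eq_iteratedFDeriv {G : V → ℂ} (hG : ContDiff ℝ (⊤ : ℕ∞) G) (v : V) (m : ℕ) (y : V) :
    dirIter v m G y = iteratedFDeriv ℝ m G y (fun _ => v) := by
  induction m generalizing y with
  | zero => simp [dirIter]
  | succ m ih =>
    have ih' : dirIter v m G = fun y => iteratedFDeriv ℝ m G y (fun _ => v) := funext ih
    rw [dirIter, Function.iterate_succ', Function.comp_apply, ← dirIter, ih']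
    have hdiff : DifferentiableAt ℝ (iteratedFDeriv ℝ m G) y :=
      (hG.differentiable_iteratedFDeriv (m := m) (by exact_mod_cast ENat.coe_lt_top m)) y
    rw [fderiv_continuousMultilinear_apply_const_apply hdiff, iteratedFDeriv_succ_apply_left]
    rfl

/-- **`‖(∂_v)^m G (y)‖ ≤ ‖D^m G(y)‖ ‖v‖^m`.** [folklore] -/
theorem norm_dirIter_le {G : V → ℂ} (hG : ContDiff ℝ (⊤ : ℕ∞) G) (v : V) (m : ℕ) (y : V) :
    ‖dirIter v m G y‖ ≤ ‖iteratedFDeriv ℝ m G y‖ * ‖v‖ ^ m := by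
  rw [dirIter_eq_iteratedFDeriv hG]
  refine (ContinuousMultilinearMap.le_opNorm _ _).trans (le_of_eq ?_)
  rw [Finset.prod_const, Finset.card_univ, Fintype.card_fin]

/-- Directional derivatives of `G ∘ A` for a continuous linear `A`:
`(∂_v)^m (G ∘ A) = ((∂_{Av})^m G) ∘ A`. [folklore] -/
theorem dirIter_comp_clm {G : V → ℂ} (hG : ContDiff ℝ (⊤ : ℕ∞) G) (A : W →L[ℝ] V) (v : W) (m : ℕ) :
    dirIter v m (fun w => G (A w)) = fun w => dirIter (A v) m G (A w) := by
  induction m with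
  | zero => rfl
  | succ m ih =>
    rw [dirIter_succ, dirIter_succ, ih]
    funext w
    have hH := (contDiff_dirIter hG (A v) m).differentiable (by simp) (A w)
    rw [show (fun w => dirIter (A v) m G (A w)) = dirIter (A v) m G ∘ A from rfl,
      fderiv_comp w hH A.differentiableAt, A.fderiv]
    rfl

end Derivatives

/-! ## The iterated partial derivatives of the descent -/

omit [MeasurableSpace E] [BorelSpace E] in
/-- **`Torus.lift ((∂ⱼ)^m (descend g)) = ((∂_{bⱼ})^m g) ∘ Ψ ∘ ofLp`**, `bⱼ = rBasis L j` the `j`-th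
basis vector: iterated partial derivatives of the descended function are the iterated directional
derivatives of `g` along the basis of the lattice. [folklore] -/
theorem lift_partialDeriv_iterate_descend {g : E → ℂ} (hg : ContDiff ℝ (⊤ : ℕ∞) g) (hper : ∀ ℓ ∈ L, ∀ x, g (x + ℓ) = g x)
    (j : Fin dE) (m : ℕ) :
    Torus.lift ((Torus.partialDeriv j)^[m] (descend (L := L) g)) =
      fun y : EuclideanSpace ℝ (Fin dE) => dirIter (rBasis L j) m g (Ψ L (WithLp.ofLp y)) := by
  -- the linear map `A = Ψ ∘ ofLp`
  set A : EuclideanSpace ℝ (Fin dE) →L[ℝ] E := (Ψ L : (Fin dE → ℝ) →L[ℝ] E).comp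
    (PiLp.continuousLinearEquiv 2 ℝ (fun _ : Fin dE => ℝ) : EuclideanSpace ℝ (Fin dE) →L[ℝ] (Fin dE → ℝ)) with hA
  have hAe : A (EuclideanSpace.single j (1 : ℝ)) = rBasis L j := by
    have h1 : A (EuclideanSpace.single j (1 : ℝ)) = (rBasis L).equivFun.symm (WithLp.ofLp (EuclideanSpace.single j (1 : ℝ))) := rfl
    rw [h1, PiLp.ofLp_single, Basis.equivFun_symm_apply,
      Finset.sum_eq_single j (fun i _ hi => by rw [Pi.single_eq_of_ne hi, zero_smul]) (fun h => absurd (Finset.mem_univ j) h),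
      Pi.single_eq_same, one_smul]
  -- induction on `m`, via `Torus.lift_lineDeriv`
  have hmain : ∀ m : ℕ, Torus.lift ((Torus.partialDeriv j)^[m] (descend (L := L) g)) = dirIter (EuclideanSpace.single j (1 : ℝ)) m (fun y => g (A y)) := by
    intro m
    induction m with
    | zero =>
      rw [Function.iterate_zero, id_eq, lift_descend hper]
      rfl
    | succ m ih =>
      rw [Function.iterate_succ', Function.comp_apply]
      have hsm : Torus.IsSmooth ((Torus.partialDeriv j)^[m] (descend (L := L) g)) :=
        Torus.isSmooth_partialDeriv_iterate (isSmooth_descend hg hper) j m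
      rw [show Torus.partialDeriv j ((Torus.partialDeriv j)^[m] (descend (L := L) g)) =
          fun x => Torus.lineDeriv ((Torus.partialDeriv j)^[m] (descend (L := L) g)) x (EuclideanSpace.single j 1) from rfl,
        Torus.lift_lineDeriv (Torus.IsSmooth.isContDiff hsm (by exact_mod_cast le_top)), ih, dirIter_succ]
  rw [hmain m, dirIter_comp_clm hg A, hAe]
  rfl

omit [MeasurableSpace E] [BorelSpace E] in
/-- **Uniform bound for the iterated partial derivatives of the descent**:
`‖(∂ⱼ)^m (descend g)‖ ≤ (sup ‖D^m g‖) ‖bⱼ‖^m`. [folklore] -/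
theorem norm_partialDeriv_iterate_descend_le {g : E → ℂ} (hg : ContDiff ℝ (⊤ : ℕ∞) g) (hper : ∀ ℓ ∈ L, ∀ x, g (x + ℓ) = g x)
    (j : Fin dE) (m : ℕ) {D : ℝ} (hD : ∀ x, ‖iteratedFDeriv ℝ m g x‖ ≤ D) (t : UnitAddTorus (Fin dE)) :
    ‖((Torus.partialDeriv j)^[m] (descend (L := L) g)) t‖ ≤ D * ‖rBasis L j‖ ^ m := by
  obtain ⟨y, rfl⟩ := Torus.proj_surjective t
  have h := congrFun (lift_partialDeriv_iterate_descend hg hper j m) y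
  rw [Torus.lift_apply] at h
  rw [h]
  refine (norm_dirIter_le hg _ m _).trans ?_
  exact mul_le_mul_of_nonneg_right (hD _) (by positivity)

/-- **Decay of the lattice Fourier coefficients of a smooth periodic function**:
`‖mean(e_{−k} g)‖ ≤ (sup ‖D^m g‖) ‖bⱼ‖^m / (2π|kⱼ|)^m`. [cite: Grafakos2014, Thm. 3.3.9] -/
theorem norm_mean_echar_mul_le {g : E → ℂ} (hg : ContDiff ℝ (⊤ : ℕ∞) g) (hper : ∀ ℓ ∈ L, ∀ x, g (x + ℓ) = g x)
    (j : Fin dE) (m : ℕ) {k : Fin dE → ℤ} (hk : k j ≠ 0) {D : ℝ} (hD : ∀ x, ‖iteratedFDeriv ℝ m g x‖ ≤ D) :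
    ‖mean L μ (fun x => echar L (-k) x * g x)‖ ≤ D * ‖rBasis L j‖ ^ m / (2 * Real.pi * |(k j : ℝ)|) ^ m := by
  rw [← mFourierCoeff_descend μ hper]
  exact Torus.norm_mFourierCoeff_le_of_partialDeriv_iterate (isSmooth_descend hg hper) j m hk
    (norm_partialDeriv_iterate_descend_le hg hper j m hD)

end Literature.Algebra.EuclideanLattices.LatticePeriodic
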